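import Summits.HodgeConjecture.CorCM.CMProductFourfoldsOfMarkman
import Summits.HodgeConjecture.CorCM.CMWeilSectionFivefold
import Summits.HodgeConjecture.CorCM.CMWeightPullbackSubproduct
import HarnessLib

/-!
# Products of pair-rigid CM abelian varieties of total dimension `5`: the Hodge conjecture from Markman's theorem

Cell `pub-hodgecm2` (COR-CM), count-neutral sub-row A3-CM45-products (fivefold assembly).  HONEST FRAMING: a CONDITIONAL
result — the Hodge conjecture for products `⨁_i A_i` of CM realisations of total dimension `5` whose CM types are
PAIR-RIGID (a balanced pair of embeddings inside one block is a conjugate pair: true for primitive types by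
`Pohlmann1968.mem_pohlmannSets_one_iff_of_isPrimitive`, and for CM elliptic curves), conditional ONLY on
`HodgeTheory.Markman2025_weilClasses_algebraic_abelianFourfold`.  `HC_CM` is never asserted.  This is the CM-product
slice of Moonen–Zarhin 1999 Thm. 0.2 (ring-2's `h02`, `MoonenZarhin1999_codimTwoHodgeClasses_abelianFivefold`) +
Markman: on such a fivefold every weight of `B² ⊗ ℂ` is either a divisor monomial or a Weil section of a COORDINATE
FOURFOLD `⨁_{i ≠ i₀} A_i` (`A_{i₀}` a CM elliptic curve), whose weight line is algebraic by the fourfold theorem and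
pulls back along the projection (`CMWeights.weightClassesAlg_map_le_algebraicClasses`).

* `isGaloisBalancedAlg_comap`, `smul_finset_map_sigma` — bookkeeping along the index embedding
  `σ_e (j, s) = (e j, s)`;
* `weightClassesAlg_le_algebraicClasses_two_five_of_markman` — `dim ⨁ A = 5`, pair-rigid types: every balanced
  `4`-weight is algebraic, granted Markman's fact;
* **`hodgeConjectureFor_biproduct_dim_five_of_markman`** — `HodgeConjectureFor 5 (⨁ A).X` for such families, granted
  Markman's fact (codimensions `0, 1, 2` directly, `3, 4, 5` by hard Lefschetz).

## References

* [MoonenZarhin1999LowDim] B. Moonen, Yu. Zarhin, Math. Ann. 315 (1999) 711–733, Thm. 0.2, (2.8), §5 (5.11).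
* [Markman2025SurveySecant] E. Markman, arXiv:2509.23403, Thm. 1.2, §1.1 and Cor. 1.3.
* [Gordon1999HodgeAVSurvey] B. B. Gordon, *A survey of the Hodge conjecture for abelian varieties*, 9.2.2.
-/

noncomputable section

open CategoryTheory CategoryTheory.Limits NumberField

namespace Summit.HodgeConjecture.CorCM.CMWeights

open Literature.AlgebraicGeometry.Motives (AbelianVariety CMType IsSmoothProjective ComplexPoints)
open Literature.AlgebraicGeometry.HodgeTheory
open Literature.AlgebraicGeometry.Pohlmann1968
open Literature.AlgebraicGeometry.ComplexMultiplication (IsCMTypeRealisation)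
open Literature.AlgebraicTopology.SingularHomology
open Literature.NumberTheory.ComplexMultiplication

open scoped Classical Pointwise

/-! ### §1 Bookkeeping along a coordinate embedding `σ_e (j, s) = (e j, s)` -/

section Bookkeeping

variable {m n : ℕ} {K : Fin n → Type} [∀ i, Field (K i)]

/-- `σ_e` commutes with the action of `Aut(ℂ)`: `τ • σ_e(S'') = σ_e(τ • S'')`. [folklore] -/
theorem smul_finset_map_sigma (e : Fin m → Fin n) (he : Function.Injective e) (τ : ℂ ≃+* ℂ)
    (S'' : Finset ((j : Fin m) × (K (e j) →+* ℂ))) :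
    τ • S''.map ⟨_, sigma_map_injective e he⟩ = (τ • S'').map ⟨_, sigma_map_injective e he⟩ := by
  ext x
  simp only [Finset.mem_smul_finset, Finset.mem_map, Function.Embedding.coeFn_mk]
  constructor
  · rintro ⟨y, ⟨z, hz, rfl⟩, rfl⟩
    exact ⟨τ • z, ⟨z, hz, rfl⟩, rfl⟩
  · rintro ⟨y, ⟨z, hz, rfl⟩, rfl⟩
    exact ⟨⟨e z.1, z.2⟩, ⟨z, hz, rfl⟩, rfl⟩

/-- Pohlmann's condition descends along `σ_e`: if `σ_e(S'')` is balanced for `(Φ_i)_i`, then `S''` is balanced for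
`(Φ_{e j})_j` (the counts correspond under the injective `σ_e`). [cite: Gordon1999HodgeAVSurvey, 9.2.2] -/
theorem isGaloisBalancedAlg_comap (e : Fin m → Fin n) (he : Function.Injective e) (Φ : ∀ i, CMType (K i))
    {S'' : Finset ((j : Fin m) × (K (e j) →+* ℂ))} (h : IsGaloisBalancedAlg Φ (S''.map ⟨_, sigma_map_injective e he⟩)) :
    IsGaloisBalancedAlg (fun j => Φ (e j)) S'' := by
  have count : ∀ (Q : ∀ i, (K i →+* ℂ) → Prop),
      {x | x ∈ S''.map ⟨_, sigma_map_injective e he⟩ ∧ Q x.1 x.2}.ncard = {x | x ∈ S'' ∧ Q (e x.1) x.2}.ncard := by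
    intro Q
    rw [show {x | x ∈ S''.map ⟨_, sigma_map_injective e he⟩ ∧ Q x.1 x.2} =
        (fun x : (j : Fin m) × (K (e j) →+* ℂ) => (⟨e x.1, x.2⟩ : (i : Fin n) × (K i →+* ℂ))) ''
          {x | x ∈ S'' ∧ Q (e x.1) x.2} by
      ext x
      simp only [Set.mem_setOf_eq, Finset.mem_map, Function.Embedding.coeFn_mk, Set.mem_image]
      constructor
      · rintro ⟨⟨y, hy, rfl⟩, hQ⟩; exact ⟨y, ⟨hy, hQ⟩, rfl⟩
      · rintro ⟨y, ⟨hy, hQ⟩, rfl⟩; exact ⟨⟨y, hy, rfl⟩, hQ⟩,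
      Set.ncard_image_of_injective _ (sigma_map_injective e he)]
  intro τ
  have h1 := h τ
  rw [count (fun i s => (τ : ℂ →+* ℂ).comp s ∈ (Φ i).1), count (fun i s => (τ : ℂ →+* ℂ).comp s ∉ (Φ i).1)] at h1
  exact h1

end Bookkeeping

/-! ### §2 Total dimension `5`: every balanced `4`-weight is algebraic, granted Markman's theorem -/

section Five

variable {n : ℕ} {K : Fin n → Type} [∀ i, Field (K i)] [∀ i, NumberField (K i)] [∀ i, IsCMField (K i)]
variable {A : Fin n → AbelianVariety ℂ} {Φ : ∀ i, CMType (K i)} {ι : ∀ i, 𝓞 (K i) →+* End (A i)}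
  {θ : ∀ i, K i →+* Module.End ℂ (complexBetti (A i).X 1)}

/-- **Every weight of `B² ⊗ ℂ` of a pair-rigid CM-product fivefold is algebraic, granted Markman's theorem.**  By the
fivefold dichotomy (`mem_pohlmannDivisorSetsAlg_two_or_weilSection_five`) a balanced `4`-weight `S` is a divisor
monomial (algebraic by Lefschetz `(1,1)`), or a Weil section of the coordinate fourfold `⨁_{i ≠ i₀} A_i`
complementary to a CM elliptic curve factor `A_{i₀}` (the `Aut(ℂ)`-stable missing pair is the whole block `i₀`, so
`[K_{i₀}:ℚ] = 2`); there its weight line is algebraic by the fourfold theorem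
(`weightClassesAlg_le_algebraicClasses_of_weilSection` + Markman), and it pulls back along the projection
(`weightClassesAlg_map_le_algebraicClasses`). [cite: MoonenZarhin1999LowDim, Thm. 0.2 and (2.8)]
[cite: Markman2025SurveySecant, Thm. 1.2 and §1.1] -/
theorem weightClassesAlg_le_algebraicClasses_two_five_of_markman
    (hW4 : Markman2025_weilClasses_algebraic_abelianFourfold) (hA : ∀ i, IsCMTypeRealisation (Φ i) (A i) (ι i) (θ i))
    (h5 : (⨁ A).dim = 5)
    (hrig : ∀ x y : (i : Fin n) × (K i →+* ℂ), x.1 = y.1 → x ≠ y →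
      IsGaloisBalancedAlg Φ ({x} ∪ ({y} : Finset _)) → y = (starRingAut : ℂ ≃+* ℂ) • x)
    {S : Finset ((i : Fin n) × (K i →+* ℂ))} (hS : S ∈ pohlmannSetsAlg Φ 2) :
    weightClassesAlg A ι (2 * 2) S ≤ algebraicClasses (⨁ A).X 2 := by
  have h10 : ∑ i, Module.finrank ℚ (K i) = 10 := by rw [sum_finrank_eq_two_mul_dim hA, h5]
  rcases mem_pohlmannDivisorSetsAlg_two_or_weilSection_five h10 Φ hrig hS with
    hD | ⟨hsec, x₀, hx₀, hx₀', hcov, hτ⟩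
  · exact weightClassesAlg_le_algebraicClasses_of_mem_pohlmannDivisorSetsAlg hA hD
  -- the block `i₀ = x₀.1` is `{x₀, ρ x₀}`: an imaginary quadratic field
  have hblock : ∀ s : K x₀.1 →+* ℂ, (⟨x₀.1, s⟩ : (i : Fin n) × (K i →+* ℂ)) = x₀ ∨
      (⟨x₀.1, s⟩ : (i : Fin n) × (K i →+* ℂ)) = (starRingAut : ℂ ≃+* ℂ) • x₀ := by
    intro s
    haveI : Countable (K x₀.1) := countable_field x₀.1
    obtain ⟨τ, hτs⟩ := Literature.AlgebraicGeometry.Motives.ZarhinLie.exists_ringEquiv_complex_comp_eq x₀.2 s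
    have hτx : τ • x₀ = ⟨x₀.1, s⟩ := by
      rw [smul_sigma_eq]
      exact congrArg (Sigma.mk x₀.1) (RingHom.ext fun b => hτs b)
    rw [← hτx]
    exact (hτ τ).1
  have hnot_block : ∀ x ∈ S, x.1 ≠ x₀.1 := by
    intro x hx h
    obtain ⟨i, s⟩ := x
    change i = x₀.1 at h
    subst h
    rcases hblock s with h' | h'
    · exact hx₀ (h' ▸ hx)
    · exact hx₀' (h' ▸ hx)
  have hK₀ : Module.finrank ℚ (K x₀.1) = 2 := by
    rw [← Embeddings.card (K x₀.1) ℂ]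
    have hne : ComplexEmbedding.conjugate x₀.2 ≠ x₀.2 := by
      intro h
      apply conj_smul_ne_self Φ x₀
      rw [conj_smul_sigma_eq]
      exact congrArg (Sigma.mk x₀.1) h
    apply le_antisymm
    · -- every embedding is `x₀.2` or its conjugate
      have hsub : (Finset.univ : Finset (K x₀.1 →+* ℂ)) ⊆ {x₀.2, ComplexEmbedding.conjugate x₀.2} := by
        intro s _
        rw [Finset.mem_insert, Finset.mem_singleton]
        rcases hblock s with h | h
        · exact Or.inl (eq_of_heq (Sigma.mk.inj_iff.1 h).2)
        · right
          rw [conj_smul_sigma_eq] at h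
          exact eq_of_heq (Sigma.mk.inj_iff.1 h).2
      calc Fintype.card (K x₀.1 →+* ℂ) = (Finset.univ : Finset (K x₀.1 →+* ℂ)).card := Finset.card_univ.symm
        _ ≤ ({x₀.2, ComplexEmbedding.conjugate x₀.2} : Finset _).card := Finset.card_le_card hsub
        _ ≤ 2 := Finset.card_le_two
    · calc 2 = ({x₀.2, ComplexEmbedding.conjugate x₀.2} : Finset _).card := by
            rw [Finset.card_pair hne.symm]
        _ ≤ Fintype.card (K x₀.1 →+* ℂ) := Finset.card_le_univ _
  -- re-index the other blocks by `Fin n'`, `n = n' + 1`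
  obtain ⟨n', rfl⟩ : ∃ n', n = n' + 1 := ⟨n - 1, by have := x₀.1.pos; omega⟩
  set e : Fin n' → Fin (n' + 1) := x₀.1.succAbove with he_def
  have he : Function.Injective e := Fin.succAbove_right_injective
  have he₀ : ∀ j, e j ≠ x₀.1 := fun j => Fin.succAbove_ne x₀.1 j
  set emb : ((j : Fin n') × (K (e j) →+* ℂ)) ↪ ((i : Fin (n' + 1)) × (K i →+* ℂ)) :=
    ⟨_, sigma_map_injective e he⟩ with hemb
  -- `S = σ_e(S'')`
  set S'' : Finset ((j : Fin n') × (K (e j) →+* ℂ)) := S.preimage emb emb.injective.injOn with hS''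
  have hSmap : S''.map emb = S := by
    ext x
    simp only [Finset.mem_map, hS'', Finset.mem_preimage]
    constructor
    · rintro ⟨y, hy, rfl⟩; exact hy
    · intro hx
      obtain ⟨j, hj⟩ := Fin.exists_succAbove_eq (hnot_block x hx)
      obtain ⟨i, s⟩ := x
      change x₀.1.succAbove j = i at hj
      subst hj
      exact ⟨⟨j, s⟩, hx, rfl⟩
  have hS''card : S''.card = 2 * 2 := by
    have h := congrArg Finset.card hSmap
    rw [Finset.card_map] at h
    rw [h]; exact hS.1
  -- the sub-family: total dimension `4`
  have hA'' : ∀ j, IsCMTypeRealisation (Φ (e j)) (A (e j)) (ι (e j)) (θ (e j)) := fun j => hA (e j)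
  have h8 : ∑ j, Module.finrank ℚ (K (e j)) = 8 := by
    have hsum := Fin.sum_univ_succAbove (fun i => Module.finrank ℚ (K i)) x₀.1
    rw [h10, hK₀] at hsum
    change 10 = 2 + ∑ j, Module.finrank ℚ (K (e j)) at hsum
    omega
  have hdim'' : (⨁ fun j => A (e j)).dim = 2 * 2 := by
    have h := sum_finrank_eq_two_mul_dim (A := fun j => A (e j)) (Φ := fun j => Φ (e j)) (ι := fun j => ι (e j))
      (θ := fun j => θ (e j)) hA''
    omega
  -- `S''` is a Weil section of the sub-family
  have hS''mem : S'' ∈ pohlmannSetsAlg (fun j => Φ (e j)) 2 :=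
    ⟨hS''card, isGaloisBalancedAlg_comap e he Φ (hSmap.symm ▸ hS.2)⟩
  have hmem_iff : ∀ y : (j : Fin n') × (K (e j) →+* ℂ), y ∈ S'' ↔ emb y ∈ S := fun y => by
    rw [← hSmap, Finset.mem_map' emb]
  have hemb_conj : ∀ y : (j : Fin n') × (K (e j) →+* ℂ), emb ((starRingAut : ℂ ≃+* ℂ) • y) = (starRingAut : ℂ ≃+* ℂ) • emb y := fun _ => rfl
  have hsec'' : ∀ y ∈ S'', (starRingAut : ℂ ≃+* ℂ) • y ∉ S'' := by
    intro y hy hy'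
    rw [hmem_iff] at hy hy'
    rw [hemb_conj] at hy'
    exact hsec _ hy hy'
  have hfull'' : ∀ y : (j : Fin n') × (K (e j) →+* ℂ), y ∈ S'' ∨ (starRingAut : ℂ ≃+* ℂ) • y ∈ S'' := by
    intro y
    rw [hmem_iff, hmem_iff, hemb_conj]
    rcases hcov (emb y) with h | h | h | h
    · exact Or.inl h
    · exact Or.inr h
    · exact absurd (congrArg Sigma.fst h) (he₀ y.1)
    · exfalso
      have h' := congrArg Sigma.fst h
      rw [conj_smul_sigma_eq] at h'
      exact he₀ y.1 h'
  have hW'' : ∀ τ : ℂ ≃+* ℂ, τ • S'' = S'' ∨ τ • S'' = (starRingAut : ℂ ≃+* ℂ) • S'' := by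
    intro τ
    rcases (hτ τ).2 with h | h
    · left
      apply Finset.map_injective emb
      rw [← smul_finset_map_sigma e he τ S'', hSmap, h]
    · right
      apply Finset.map_injective emb
      rw [← smul_finset_map_sigma e he τ S'', ← smul_finset_map_sigma e he _ S'', hSmap, h]
  -- the weight line of `S''` on the coordinate fourfold is algebraic (Markman), and pulls back
  have halg'' : weightClassesAlg (fun j => A (e j)) (fun j => ι (e j)) (2 * 2) S'' ≤
      algebraicClasses (⨁ fun j => A (e j)).X 2 := by
    refine weightClassesAlg_le_algebraicClasses_of_weilSection hA'' (by norm_num) hdim'' hS''mem hsec'' hfull'' hW'' ?_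
    intro d φ hd hφ c hcW hcQ hcH
    have hX : IsSmoothProjective (2 * 2) (⨁ fun j => A (e j)).X := by
      rw [← hdim'']; exact AbelianVariety.isSmoothProjective_holds
    exact hW4 d hd _ φ hdim'' hX hφ c hcQ hcH hcW
  have h := weightClassesAlg_map_le_algebraicClasses hA e he hS''card halg''
  rw [hSmap] at h
  exact h

/-- **Codimension `2` on a pair-rigid CM-product fivefold, granted Markman's theorem**: every rational `(2,2)` class
on `⨁_i A_i` (`dim = 5`, pair-rigid types) is algebraic (Pohlmann's theorem + the previous theorem weight by
weight). [cite: MoonenZarhin1999LowDim, Thm. 0.2] [cite: Markman2025SurveySecant, §1.1 and Cor. 1.3] -/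
theorem mem_algebraicClasses_two_biproduct_five_of_markman (hW4 : Markman2025_weilClasses_algebraic_abelianFourfold)
    (hA : ∀ i, IsCMTypeRealisation (Φ i) (A i) (ι i) (θ i)) (h5 : (⨁ A).dim = 5)
    (hrig : ∀ x y : (i : Fin n) × (K i →+* ℂ), x.1 = y.1 → x ≠ y →
      IsGaloisBalancedAlg Φ ({x} ∪ ({y} : Finset _)) → y = (starRingAut : ℂ ≃+* ℂ) • x)
    (c : complexBetti (⨁ A).X (2 * 2)) (hcQ : IsRationalClass c) (hcH : IsOfHodgeType (⨁ A).dim (⨁ A).X (2 * 2) 2 2 c) :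
    c ∈ algebraicClasses (⨁ A).X 2 := by
  have hle : (⨆ S ∈ pohlmannSetsAlg Φ 2, weightClassesAlg A ι (2 * 2) S) ≤ algebraicClasses (⨁ A).X 2 :=
    iSup₂_le fun S hS => weightClassesAlg_le_algebraicClasses_two_five_of_markman hW4 hA h5 hrig hS
  exact hle (mem_iSup_weightClassesAlg hA hcQ hcH)

/-- **The Hodge conjecture for a product of pair-rigid CM abelian varieties of total dimension `5`, granted Markman's
theorem on the Weil classes of abelian fourfolds.**  Codimension `0` (`hodgeConjectureFor_codim_zero`), `1`
(Lefschetz `(1,1)`), `2` (`mem_algebraicClasses_two_biproduct_five_of_markman`), and `3, 4, 5` by hard Lefschetz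
(`nonempty_hardLefschetzNFold_holds`).  The CM-product slice of the fact `Markman2025_hodgeClasses_algebraic_abelian_dim_le_five`
at dimension `5`, with Moonen–Zarhin's Thm. 0.2 replaced by Pohlmann's theorem and the fivefold dichotomy; the
pair-rigidity hypothesis holds for primitive types (`mem_pohlmannSets_one_iff_of_isPrimitive`).
[cite: Markman2025SurveySecant, §1.1 and Cor. 1.3] [cite: MoonenZarhin1999LowDim, Thm. 0.2]
[cite: VoisinHodgeI2002, Thm. 6.25 and Thm. 11.30] -/
theorem hodgeConjectureFor_biproduct_dim_five_of_markman (hW4 : Markman2025_weilClasses_algebraic_abelianFourfold)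
    (hA : ∀ i, IsCMTypeRealisation (Φ i) (A i) (ι i) (θ i))
    (hrig : ∀ x y : (i : Fin n) × (K i →+* ℂ), x.1 = y.1 → x ≠ y →
      IsGaloisBalancedAlg Φ ({x} ∪ ({y} : Finset _)) → y = (starRingAut : ℂ ≃+* ℂ) • x)
    (h5 : (⨁ A).dim = 5) : HodgeConjectureFor 5 (⨁ A).X := by
  have hX : IsSmoothProjective (⨁ A).dim (⨁ A).X := AbelianVariety.isSmoothProjective_holds
  rw [← h5]
  refine ⟨nonempty_hodgeModel_holds hX, fun p c hc hpp => ?_⟩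
  have low : ∀ (q : ℕ) (c : complexBetti (⨁ A).X (2 * q)), 2 * q ≤ (⨁ A).dim → IsRationalClass c →
      IsOfHodgeType (⨁ A).dim (⨁ A).X (2 * q) q q c → c ∈ algebraicClasses (⨁ A).X q := by
    intro q c hq hc hqq
    have hq2 : q ≤ 2 := by omega
    interval_cases q
    · exact hodgeConjectureFor_codim_zero c
    · exact lefschetzOneOne_rational_holds hX c hc hqq
    · exact mem_algebraicClasses_two_biproduct_five_of_markman hW4 hA h5 hrig c hc hqq
  rcases Nat.lt_or_ge (⨁ A).dim (2 * p) with hlt | hge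
  · exact mem_algebraicClasses_of_lt_of_nonempty (nonempty_hardLefschetzNFold_holds _ _) hX hlt
      (fun c' hc' hpp' ↦ low ((⨁ A).dim - p) c' (by omega) hc' hpp') c hc hpp
  · exact low p c hge hc hpp

end Five

end Summit.HodgeConjecture.CorCM.CMWeights

end
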